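import Summits.CriticalPhenomena.PercolationContinuityZ3.Theorems.PercNearOneGluingNoHeavyLowerTailCondCertCols
import HarnessLib

/-!
# `NoHeavyLowerTail` (stmt-CriticalPhenomena-4575) — `COND₃`/`KN13` certificate wrapper, part 2: the structure `CondCert`, checks, soundness

Support file (prover prim-ineq-prove-1; `--supports stmt-CriticalPhenomena-4575`).  Bookkeeping definitions + soundness; no sorries.
* `CondCert` — multiplier `M₀`, single rows (`ts/kn`, two-set DNF, pattern Harris, van den Berg–Kahn `mix`, cluster-conditioned BK `ccbk`),
  row groups (sunflower, order-dual sunflower, and the OPTIONAL k-petal sunflower / Gladkov–Zimin kernel groups of `…CertRowsGroupData`, whose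
  summed validity enters as the hypothesis `ExtSound C` — vacuous when unused), hypothesis×row groups (`HRSpec`, `HRKSpec`), hypothesis rows;
* `rowsValid` / `hypsWithin` / `valid` (decidable side conditions; `valid` = rows valid and only the `COND₃` hypotheses `(2,1),(3,1)` used),
  `posTerm`; `checkTB` (streaming bucketed coefficientwise domination, `= CertCheck.checkQB` by `checkQBs_eq`), `checkB` (`COND₃` target);
* `soundT` — for ANY quadratic target and ANY hypothesis pairs: row-valid + buckets pass + hypotheses hold ⇒ `0 ≤ M₀(x)·ts(x)` at the cell law;
  `sound`, `cond_interior` — the `COND₃` instance (interior weights, injective placement).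
[cite: KozmaNitzan2024, Conjecture 1 (p. 3)]
-/

noncomputable section

namespace Summit.CriticalPhenomena.PercolationContinuityZ3.Theorems

open MeasureTheory Set Filter Literature.Probability.Percolation
open Literature.Probability.LatticeModels (prodBernoulli)
open scoped Classical BigOperators Topology
open PatternCells CertCheck CertCells PatternSunflower

namespace CondCert

variable {n : ℕ}

/-! ## The certificate structure -/

/-- A certificate: multiplier `M₀`, product rows and row groups, hypothesis rows `μ(D_lo) ≤ μ(D_hi)` with monomial multipliers.
[folklore] -/
structure _root_.Summit.CriticalPhenomena.PercolationContinuityZ3.Theorems.CondCert where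
  /-- the multiplier `M₀ = Σ w·m` (cell monomials) -/
  M0 : List (List ℕ × ℕ)
  /-- the factored part of the multiplier: `Σ w · Π masses` (each mass a cell list) -/
  M0F : List (List (List ℕ) × ℕ)
  /-- `ts`/`kn` rows -/
  rows : List RowSpec
  /-- two-set formula rows -/
  rowsTS : List RowSpecTS
  /-- pattern Harris rows -/
  rowsP : List RowSpecP
  /-- van den Berg–Kahn two-separation rows (`mix`) -/
  rowsV : List RowSpecV
  /-- cluster-conditioned BK rows (`ccbk`) -/
  rowsCC : List RowSpecCC
  /-- three-petal sunflower row groups -/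
  rowsSF : List SFSpec
  /-- k-petal sunflower row groups (soundness supplied as the hypothesis `ExtSound.sfk`) -/
  rowsSFK : List SFKSpec
  /-- Gladkov–Zimin kernel row groups (soundness supplied as the hypothesis `ExtSound.gz`) -/
  rowsGZ : List GZSpec
  /-- raw row groups of any other provenance (their summed validity `GroupHolds` is supplied as a hypothesis, `ExtSound`) -/
  rowsX : List (List Row)
  /-- hypothesis×row groups -/
  rowsHR : List HRSpec
  /-- hypothesis × k-petal sunflower groups -/
  rowsHRK : List HRKSpec
  /-- columns with FACTORED (product-of-masses) multipliers on typed bases -/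
  colsF : List FCol
  /-- columns with factored multipliers on k-petal sunflower bases -/
  colsFK : List FColK
  /-- hypothesis rows with factored multipliers -/
  hlinF : List FLin
  /-- hypothesis rows: `((lo, hi), m, w)` encodes `w · m · (μ(D_hi) − μ(D_lo)) ≥ 0` -/
  hlin : List ((Fin 5 × Fin 5) × List ℕ × ℕ)

/-- The hypothesis pairs of `COND₃` with worst relay `a₁`: `μ(D₂) ≤ μ(D₁)`, `μ(D₃) ≤ μ(D₁)`. [folklore] -/
def condHyps : List (Fin 5 × Fin 5) := [(2, 1), (3, 1)]

/-- The singly valid product rows of a certificate, as checker rows. [folklore] -/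
def singleRows (C : CondCert) : List Row :=
  C.rows.map RowSpec.toRow ++ C.rowsTS.map RowSpecTS.toRow ++ C.rowsP.map RowSpecP.toRow ++ C.rowsV.map RowSpecV.toRow ++
    C.rowsCC.map RowSpecCC.toRow

/-- The rows of the unconditionally valid row GROUPS (sunflowers, order-dual sunflowers, …). [folklore] -/
def groupRows (C : CondCert) : List Row :=
  C.rowsSF.flatMap SFSpec.rows ++ C.rowsSFK.flatMap SFKSpec.rows ++ C.rowsGZ.flatMap GZSpec.rows ++
    C.rowsX.flatMap id

/-- All product rows of a certificate (single rows, the groups, the hypothesis×row groups). [folklore] -/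
def allRows (C : CondCert) : List Row := singleRows C ++ groupRows C ++ (C.rowsHR.flatMap HRSpec.rows ++ C.rowsHRK.flatMap HRKSpec.rows)

/-- The linear (hypothesis) rows of a certificate. [folklore] -/
def linRows (C : CondCert) : List LinRow :=
  C.hlin.map fun q => (⟨cellsOf (fD q.1.1), cellsOf (fD q.1.2), q.2.1, q.2.2⟩ : LinRow)

/-- Side conditions of the single rows (decidable). [folklore] -/
def singlesValid (C : CondCert) : Bool :=
  C.rows.all RowSpec.valid && C.rowsTS.all RowSpecTS.valid && C.rowsP.all RowSpecP.valid && C.rowsCC.all RowSpecCC.valid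

/-- Side conditions of the row groups (decidable). [folklore] -/
def groupsValid (C : CondCert) : Bool :=
  C.rowsSF.all SFSpec.valid && C.rowsSFK.all SFKSpec.valid && C.rowsGZ.all GZSpec.valid

/-- Side conditions of all rows (decidable). [folklore] -/
def rowsValid (C : CondCert) : Bool :=
  singlesValid C && groupsValid C && (C.rowsHR.all HRSpec.valid && C.rowsHRK.all fun h => h.base.valid) &&
    (C.colsF.all FCol.valid && C.colsFK.all fun c => c.base.valid)

/-- All hypotheses used (linear rows and hypothesis×row groups) belong to `allowed` (decidable). [folklore] -/
def hypsWithin (C : CondCert) (allowed : List (Fin 5 × Fin 5)) : Bool :=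
  (C.hlin.all fun q => decide (q.1 ∈ allowed)) && (C.rowsHR.all fun h => decide (h.hyp ∈ allowed)) &&
    (C.rowsHRK.all fun h => decide (h.hyp ∈ allowed)) && C.hlinF.all fun h => decide (h.hyp ∈ allowed)

/-- `ExtSound C`: the soundness obligations of the OPTIONAL group families of a certificate — vacuous when the families are unused,
discharged by `CertCells.sfkSound` / `CertCells.gzSound` (`…CertRowsSFK` / `…CertRowsGZ`) otherwise (a predicate with parameters,
not a statement). [folklore] -/
def ExtSound (C : CondCert) : Prop :=
  (C.rowsSFK ≠ [] → ∀ s : SFKSpec, s.valid = true → GroupHolds s.rows) ∧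
    (C.rowsHRK ≠ [] → ∀ s : SFKSpec, s.valid = true → GroupHolds s.rows) ∧
      (C.rowsGZ ≠ [] → ∀ s : GZSpec, s.valid = true → GroupHolds s.rows) ∧
        (∀ g ∈ C.rowsX, GroupHolds g) ∧
          (C.colsFK ≠ [] → ∀ s : SFKSpec, s.valid = true → GroupHolds s.rows)

/-- All obligations from the two family soundness facts (no raw groups). [folklore] -/
theorem extSound_of (C : CondCert) (hS : ∀ s : SFKSpec, s.valid = true → GroupHolds s.rows)
    (hG : ∀ s : GZSpec, s.valid = true → GroupHolds s.rows) (hX : C.rowsX = []) : C.ExtSound :=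
  ⟨fun _ => hS, fun _ => hS, fun _ => hG, by rw [hX]; simp, fun _ => hS⟩

/-- Without Gladkov–Zimin groups and raw groups, k-petal soundness suffices. [folklore] -/
theorem extSound_of_sfk (C : CondCert) (hS : ∀ s : SFKSpec, s.valid = true → GroupHolds s.rows) (hG0 : C.rowsGZ = [])
    (hX : C.rowsX = []) : C.ExtSound := ⟨fun _ => hS, fun _ => hS, fun h => absurd hG0 h, by rw [hX]; simp, fun _ => hS⟩

/-- Without any optional groups there is nothing to discharge. [folklore] -/
theorem extSound_of_nil (C : CondCert) (h1 : C.rowsSFK = []) (h2 : C.rowsHRK = []) (h3 : C.rowsGZ = []) (h4 : C.rowsX = [])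
    (h5 : C.colsFK = []) : C.ExtSound :=
  ⟨fun h => absurd h1 h, fun h => absurd h2 h, fun h => absurd h3 h, by rw [h4]; simp, fun h => absurd h5 h⟩

/-- With raw groups: their summed validity discharged explicitly. [folklore] -/
theorem extSound_of_raw (C : CondCert) (hS : ∀ s : SFKSpec, s.valid = true → GroupHolds s.rows)
    (hG : C.rowsGZ ≠ [] → ∀ s : GZSpec, s.valid = true → GroupHolds s.rows) (hX : ∀ g ∈ C.rowsX, GroupHolds g) : C.ExtSound :=
  ⟨fun _ => hS, fun _ => hS, hG, hX, fun _ => hS⟩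

/-- Validity of a `COND₃` certificate: rows valid and only the two `COND₃` hypotheses used. [folklore] -/
def valid (C : CondCert) : Bool := rowsValid C && hypsWithin C condHyps

/-- The factored columns' SMALL sides in bucket `b` (they join the minus list). [folklore] -/
def fSmallB (C : CondCert) (nb b : ℕ) : List (List Term) :=
  C.colsF.map (FCol.smallB nb b) ++ C.colsFK.map (FColK.smallB nb b) ++ C.hlinF.map (FLin.loB nb b)

/-- The factored columns' LARGE sides in bucket `b` (they join the plus list). [folklore] -/
def fLargeB (C : CondCert) (nb b : ℕ) : List (List Term) :=
  C.colsF.map (FCol.largeB nb b) ++ C.colsFK.map (FColK.largeB nb b) ++ C.hlinF.map (FLin.hiB nb b)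

/-- THE bucketed kernel check for a general quadratic target `ts` (bucket `b` of `nb`; merge-accumulating, with factored columns).
[folklore] -/
def checkTB (C : CondCert) (ts : List QTerm) (nb b : ℕ) : Bool :=
  dominated (accTerms (plusColsB nb b (qTerms C.M0 ts false ++ qTermsF C.M0F ts false) (allRows C) (linRows C) ++ fLargeB C nb b))
    (accTerms (minusColsB nb b (qTerms C.M0 ts true ++ qTermsF C.M0F ts true) (allRows C) (linRows C) ++ fSmallB C nb b))

/-- The total multiplier value `M₀(x) + M₀ᶠ(x)`. [folklore] -/
def m0tot (x : ℕ → ℝ) (C : CondCert) : ℝ := m0val x C.M0 + m0valF x C.M0F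

/-- Value of a concatenation of column lists. [folklore] -/
theorem evalT_flatten_append (x : ℕ → ℝ) (a b : List (List Term)) :
    evalT x (a ++ b).flatten = evalT x a.flatten + evalT x b.flatten := by
  rw [List.flatten_append, evalT_append]

/-- Value of a flattened `map` as a sum. [folklore] -/
theorem evalT_flatten_map {α : Type*} (x : ℕ → ℝ) (l : List α) (f : α → List Term) :
    evalT x (l.map f).flatten = (l.map fun a => evalT x (f a)).sum := by
  induction l with
  | nil => simp [evalT]
  | cons a t ih => rw [List.map_cons, List.flatten_cons, evalT_append, ih, List.map_cons, List.sum_cons]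

/-- The bucketed kernel check for the `COND₃` target (bucket `b` of `nb`). [folklore] -/
def checkB (C : CondCert) (nb b : ℕ) : Bool := checkTB C qts nb b

/-- A monomial of `M₀` with positive weight on consistent cells (decidable). [folklore] -/
def posTerm (C : CondCert) : Bool :=
  (C.M0.any fun p => decide (0 < p.2) && p.1.all fun c => decide (c ∈ consPatterns)) ||
    C.M0F.any fun p => decide (0 < p.2) && p.1.all fun f => f.any fun c => decide (c ∈ consPatterns)

/-- From `0 < a` and `0 ≤ a * b` conclude `0 ≤ b`. [folklore] -/
theorem nonneg_of_mul_pos_left {a b : ℝ} (h : 0 ≤ a * b) (ha : 0 < a) : 0 ≤ b := by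
  by_contra hb
  push Not at hb
  have : a * b < 0 := mul_neg_of_pos_of_neg ha hb
  linarith

/-- **Positivity of the total multiplier** at interior weights and an injective placement, from `posTerm`. [folklore] -/
theorem m0tot_pos (C : CondCert) (hterm : posTerm C = true) (w : Sym2 (Fin n) → unitInterval)
    (hw : ∀ e : Sym2 (Fin n), ¬ e.IsDiag → 0 < ((w e : unitInterval) : ℝ) ∧ ((w e : unitInterval) : ℝ) < 1)
    {v : Fin 5 → Fin n} (hv : Function.Injective v) :
    0 < m0tot (fun m => (prodBernoulli w).real (Cell v m)) C := by
  have hx : ∀ i, 0 ≤ (fun m => (prodBernoulli w).real (Cell v m)) i := fun _ => measureReal_nonneg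
  unfold posTerm at hterm
  rw [Bool.or_eq_true] at hterm
  unfold m0tot
  rcases hterm with h | h
  · obtain ⟨p₀, hp₀, hwa⟩ := List.any_eq_true.1 h
    rw [Bool.and_eq_true, decide_eq_true_eq, List.all_eq_true] at hwa
    obtain ⟨hwt, hmult⟩ := hwa
    have hM : 0 < m0val (fun m => (prodBernoulli w).real (Cell v m)) C.M0 :=
      m0val_pos _ hx C.M0 hp₀ (by exact_mod_cast hwt) fun c hc => cell_pos w hw hv (by simpa using hmult c hc)
    linarith [m0valF_nonneg _ hx C.M0F]
  · obtain ⟨p₀, hp₀, hwa⟩ := List.any_eq_true.1 h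
    rw [Bool.and_eq_true, decide_eq_true_eq, List.all_eq_true] at hwa
    obtain ⟨hwt, hfac⟩ := hwa
    have hM : 0 < m0valF (fun m => (prodBernoulli w).real (Cell v m)) C.M0F :=
      m0valF_pos _ hx C.M0F hp₀ (by exact_mod_cast hwt) fun f hf => by
        obtain ⟨c, hc, hcc⟩ := List.any_eq_true.1 (hfac f hf)
        exact ⟨c, hc, cell_pos w hw hv (by simpa using hcc)⟩
    linarith [m0val_nonneg _ hx C.M0]

/-- The single rows of a certificate with valid singles hold at every cell law. [folklore] -/
theorem singleRows_holds (C : CondCert) (hvalid : singlesValid C = true) (w : Sym2 (Fin n) → unitInterval) (v : Fin 5 → Fin n) :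
    ∀ r ∈ singleRows C,
      linEval (fun m => (prodBernoulli w).real (Cell v m)) r.e1 * linEval (fun m => (prodBernoulli w).real (Cell v m)) r.e2 ≤
        linEval (fun m => (prodBernoulli w).real (Cell v m)) r.e3 * linEval (fun m => (prodBernoulli w).real (Cell v m)) r.e4 := by
  simp only [singlesValid, Bool.and_eq_true, List.all_eq_true] at hvalid
  obtain ⟨⟨⟨h1, h2⟩, h3⟩, h4⟩ := hvalid
  intro r hr
  simp only [singleRows, List.mem_append, List.mem_map] at hr
  rcases hr with (((⟨s, hs, rfl⟩ | ⟨s, hs, rfl⟩) | ⟨s, hs, rfl⟩) | ⟨s, _, rfl⟩) | ⟨s, hs, rfl⟩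
  · exact RowSpec.holds s (h1 s hs) w v
  · exact RowSpecTS.holds s (h2 s hs) w v
  · exact RowSpecP.holds s (h3 s hs) w v
  · exact RowSpecV.holds s w v
  · exact RowSpecCC.holds s (h4 s hs) w v

/-- The rows of valid groups hold IN SUM at every cell law. [folklore] -/
theorem sfk_rowSum_all (specs : List SFKSpec) (hvalid : specs.all SFKSpec.valid = true) (hS : specs ≠ [] → ∀ s : SFKSpec, s.valid = true → GroupHolds s.rows)
    (w : Sym2 (Fin n) → unitInterval) (v : Fin 5 → Fin n) :
    let x : ℕ → ℝ := fun m => (prodBernoulli w).real (Cell v m)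
    ((specs.flatMap SFKSpec.rows).map fun r => (r.wt : ℝ) * evalM x r.mult * (linEval x r.e1 * linEval x r.e2)).sum ≤
      ((specs.flatMap SFKSpec.rows).map fun r => (r.wt : ℝ) * evalM x r.mult * (linEval x r.e3 * linEval x r.e4)).sum := by
  by_cases h : specs = []
  · subst h; intro x; simp
  · rw [List.all_eq_true] at hvalid
    exact groupHolds_flatMap specs SFKSpec.rows (fun a ha => hS h a (hvalid a ha)) n w v

/-- Gladkov–Zimin groups hold in sum, given their soundness when present. [folklore] -/
theorem gz_rowSum_all (specs : List GZSpec) (hvalid : specs.all GZSpec.valid = true) (hG : specs ≠ [] → ∀ s : GZSpec, s.valid = true → GroupHolds s.rows)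
    (w : Sym2 (Fin n) → unitInterval) (v : Fin 5 → Fin n) :
    let x : ℕ → ℝ := fun m => (prodBernoulli w).real (Cell v m)
    ((specs.flatMap GZSpec.rows).map fun r => (r.wt : ℝ) * evalM x r.mult * (linEval x r.e1 * linEval x r.e2)).sum ≤
      ((specs.flatMap GZSpec.rows).map fun r => (r.wt : ℝ) * evalM x r.mult * (linEval x r.e3 * linEval x r.e4)).sum := by
  by_cases h : specs = []
  · subst h; intro x; simp
  · rw [List.all_eq_true] at hvalid
    exact groupHolds_flatMap specs GZSpec.rows (fun a ha => hG h a (hvalid a ha)) n w v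

/-- The rows of valid groups hold IN SUM at every cell law (given the optional families' soundness). [folklore] -/
theorem groupRows_rowSum (C : CondCert) (hvalid : groupsValid C = true) (hx : C.ExtSound) (w : Sym2 (Fin n) → unitInterval)
    (v : Fin 5 → Fin n) :
    let x : ℕ → ℝ := fun m => (prodBernoulli w).real (Cell v m)
    ((groupRows C).map fun r => (r.wt : ℝ) * evalM x r.mult * (linEval x r.e1 * linEval x r.e2)).sum ≤
      ((groupRows C).map fun r => (r.wt : ℝ) * evalM x r.mult * (linEval x r.e3 * linEval x r.e4)).sum := by
  intro x
  simp only [groupsValid, Bool.and_eq_true] at hvalid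
  simp only [groupRows, List.map_append, List.sum_append]
  obtain ⟨⟨hSF, hSFK⟩, hGZ⟩ := hvalid
  exact add_le_add (add_le_add (add_le_add (SFSpec.rowSum_all C.rowsSF hSF w v)
    (sfk_rowSum_all C.rowsSFK hSFK hx.1 w v)) (gz_rowSum_all C.rowsGZ hGZ hx.2.2.1 w v)) (groupHolds_flatMap C.rowsX id hx.2.2.2.1 n w v)

/-- **All rows of a row-valid certificate hold IN SUM at every cell law satisfying the hypotheses of its hypothesis×row groups.**
[folklore] -/
theorem allRows_rowSum (C : CondCert) (hvalid : rowsValid C = true) (hx : C.ExtSound) (w : Sym2 (Fin n) → unitInterval)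
    (v : Fin 5 → Fin n)
    (hh : ∀ h ∈ C.rowsHR, (prodBernoulli w).real ((fD h.hyp.1).set v) ≤ (prodBernoulli w).real ((fD h.hyp.2).set v))
    (hhk : ∀ h ∈ C.rowsHRK, (prodBernoulli w).real ((fD h.hyp.1).set v) ≤ (prodBernoulli w).real ((fD h.hyp.2).set v)) :
    let x : ℕ → ℝ := fun m => (prodBernoulli w).real (Cell v m)
    ((allRows C).map fun r => (r.wt : ℝ) * evalM x r.mult * (linEval x r.e1 * linEval x r.e2)).sum ≤
      ((allRows C).map fun r => (r.wt : ℝ) * evalM x r.mult * (linEval x r.e3 * linEval x r.e4)).sum := by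
  intro x
  have hx0 : ∀ i, 0 ≤ x i := fun _ => measureReal_nonneg
  simp only [rowsValid, Bool.and_eq_true] at hvalid
  obtain ⟨⟨⟨hS, hG⟩, hHR, hHRK⟩, _⟩ := hvalid
  rw [allRows, List.map_append, List.map_append, List.sum_append, List.sum_append, List.map_append, List.map_append,
    List.sum_append, List.sum_append, List.map_append, List.map_append, List.sum_append, List.sum_append]
  exact add_le_add (add_le_add (rowSumLE_of_forall x hx0 _ (singleRows_holds C hS w v)) (groupRows_rowSum C hG hx w v))
    (add_le_add (HRSpec.rowSum_all C.rowsHR hHR w v hh) (HRKSpec.rowSum_all C.rowsHRK hHRK hx.2.1 w v hhk))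

/-- The hypothesis rows hold when their hypotheses hold for the placement `v`. [folklore] -/
theorem linRows_holds (C : CondCert) (w : Sym2 (Fin n) → unitInterval) (v : Fin 5 → Fin n)
    (hh : ∀ q ∈ C.hlin, (prodBernoulli w).real ((fD q.1.1).set v) ≤ (prodBernoulli w).real ((fD q.1.2).set v)) :
    ∀ r ∈ linRows C,
      linEval (fun m => (prodBernoulli w).real (Cell v m)) r.eLo ≤ linEval (fun m => (prodBernoulli w).real (Cell v m)) r.eHi := by
  intro r hr
  simp only [linRows, List.mem_map] at hr
  obtain ⟨q, hq, rfl⟩ := hr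
  simpa only [← measureReal_set_eq_linEval] using hh q hq

/-- The value of the target form at the cell law: `μ(oA)·μ(D₁) − μ(X)`. [folklore] -/
theorem qval_qts (w : Sym2 (Fin n) → unitInterval) (v : Fin 5 → Fin n) :
    qval (fun m => (prodBernoulli w).real (Cell v m)) qts =
      (prodBernoulli w).real (fOA.set v) * (prodBernoulli w).real ((fD 1).set v) - (prodBernoulli w).real (fX.set v) := by
  haveI : IsProbabilityMeasure (prodBernoulli w) := inferInstance
  have htop : (prodBernoulli w).real (fTop.set v) = 1 := by
    have : fTop.set v = (Set.univ : Set (BondConfig (Fin n))) := by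
      ext ω; simp [fTop, Formula.set]
    rw [this, probReal_univ]
  simp only [qval, qts, QTerm.val, List.map_cons, List.map_nil, List.sum_cons, List.sum_nil, ← measureReal_set_eq_linEval,
    htop, Nat.cast_one, one_mul, mul_one, if_true, Bool.false_eq_true, if_false]
  ring

/-- **Soundness at the cell law, general quadratic target and hypotheses.**  Row-valid certificate, all buckets of `checkTB C ts`
pass, every hypothesis used holds for the placement `v` ⇒ `0 ≤ M₀(x) · ts(x)` at `x_c = μ(Cell v c)`. [folklore] -/
theorem soundT (C : CondCert) (ts : List QTerm) (hvalid : rowsValid C = true) (hxs : C.ExtSound) {nb : ℕ} (hnb : 0 < nb)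
    (hcheck : ∀ b < nb, checkTB C ts nb b = true)
    (w : Sym2 (Fin n) → unitInterval) (v : Fin 5 → Fin n)
    (hhl : ∀ q ∈ C.hlin, (prodBernoulli w).real ((fD q.1.1).set v) ≤ (prodBernoulli w).real ((fD q.1.2).set v))
    (hhr : ∀ h ∈ C.rowsHR, (prodBernoulli w).real ((fD h.hyp.1).set v) ≤ (prodBernoulli w).real ((fD h.hyp.2).set v))
    (hhk : ∀ h ∈ C.rowsHRK, (prodBernoulli w).real ((fD h.hyp.1).set v) ≤ (prodBernoulli w).real ((fD h.hyp.2).set v))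
    (hhf : ∀ h ∈ C.hlinF, (prodBernoulli w).real ((fD h.hyp.1).set v) ≤ (prodBernoulli w).real ((fD h.hyp.2).set v)) :
    0 ≤ m0tot (fun m => (prodBernoulli w).real (Cell v m)) C * qval (fun m => (prodBernoulli w).real (Cell v m)) ts := by
  set x : ℕ → ℝ := fun m => (prodBernoulli w).real (Cell v m) with hxdef
  have hx : ∀ i, 0 ≤ x i := fun _ => measureReal_nonneg
  have hrv := hvalid
  simp only [rowsValid, Bool.and_eq_true] at hrv
  obtain ⟨_, hF, hFK⟩ := hrv
  set P := qTerms C.M0 ts false ++ qTermsF C.M0F ts false with hP0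
  set M := qTerms C.M0 ts true ++ qTermsF C.M0F ts true with hM0
  -- per bucket: plus columns + factored large ≤ minus columns + factored small
  have hb : ∀ b < nb, evalT x (plusTermsGB nb b P (allRows C) (linRows C)) +
      ((C.colsF.map fun c => evalT x (c.largeB nb b)).sum + (C.colsFK.map fun c => evalT x (c.largeB nb b)).sum +
        (C.hlinF.map fun h => evalT x (h.hiB nb b)).sum) ≤
      evalT x (minusTermsGB nb b M (allRows C) (linRows C)) +
      ((C.colsF.map fun c => evalT x (c.smallB nb b)).sum + (C.colsFK.map fun c => evalT x (c.smallB nb b)).sum +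
        (C.hlinF.map fun h => evalT x (h.loB nb b)).sum) := by
    intro b hbn
    have h := evalT_le_of_dominated x hx _ _ (hcheck b hbn)
    rw [evalT_accTerms, evalT_accTerms, evalT_flatten_append, evalT_flatten_append, flatten_plusColsB, flatten_minusColsB,
      fLargeB, fSmallB, evalT_flatten_append, evalT_flatten_append, evalT_flatten_append, evalT_flatten_append,
      evalT_flatten_map, evalT_flatten_map, evalT_flatten_map, evalT_flatten_map, evalT_flatten_map, evalT_flatten_map] at h
    linarith
  have hsum : ((List.range nb).map fun b => evalT x (plusTermsGB nb b P (allRows C) (linRows C)) +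
      ((C.colsF.map fun c => evalT x (c.largeB nb b)).sum + (C.colsFK.map fun c => evalT x (c.largeB nb b)).sum +
        (C.hlinF.map fun h => evalT x (h.hiB nb b)).sum)).sum ≤
      ((List.range nb).map fun b => evalT x (minusTermsGB nb b M (allRows C) (linRows C)) +
      ((C.colsF.map fun c => evalT x (c.smallB nb b)).sum + (C.colsFK.map fun c => evalT x (c.smallB nb b)).sum +
        (C.hlinF.map fun h => evalT x (h.loB nb b)).sum)).sum :=
    List.sum_le_sum fun b hbm => hb b (List.mem_range.1 hbm)
  simp only [List.sum_map_add] at hsum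
  have hP : ((List.range nb).map fun b => evalT x (plusTermsGB nb b P (allRows C) (linRows C))).sum =
      evalT x (plusTermsG P (allRows C) (linRows C)) := by
    rw [evalT_eq_sum_buckets x hnb (plusTermsG _ _ _)]; simp only [plusTermsGB_eq]
  have hM : ((List.range nb).map fun b => evalT x (minusTermsGB nb b M (allRows C) (linRows C))).sum =
      evalT x (minusTermsG M (allRows C) (linRows C)) := by
    rw [evalT_eq_sum_buckets x hnb (minusTermsG _ _ _)]; simp only [minusTermsGB_eq]
  have hF' := FCol.sum_all C.colsF hF hnb w v
  have hFK' := FColK.sum_all C.colsFK hFK hxs.2.2.2.2 hnb w v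
  have hFL' := FLin.sum_all C.hlinF hnb w v hhf
  have hdom : evalT x (plusTermsG P (allRows C) (linRows C)) ≤ evalT x (minusTermsG M (allRows C) (linRows C)) := by
    rw [← hP, ← hM]
    change _ ≤ _ at hF'
    change _ ≤ _ at hFK'
    change _ ≤ _ at hFL'
    linarith
  have key := le_of_evalT_G_le x hx _ _ (allRows C) (linRows C) (allRows_rowSum C hvalid hxs w v hhr hhk) (linRows_holds C w v hhl) hdom
  rw [hP0, hM0, evalT_append, evalT_append, evalT_qTerms, evalT_qTerms, evalT_qTermsF, evalT_qTermsF] at key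
  rw [m0tot, qval_eq, mul_sub]
  nlinarith [key]

end CondCert

end Summit.CriticalPhenomena.PercolationContinuityZ3.Theorems

end
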